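import Mathlib
import Summits.ValiantsHypothesis.ValiantsHypothesis.Theorems.BarrierLeverPartitionMinorsHitByVPSimplexJoinTwoSlotsLevels
import Summits.ValiantsHypothesis.ValiantsHypothesis.Theorems.BarrierLeverPartitionMinorsHitByVPHiddenStatesUniversalConstraints

/-!
# Route BarrierLever — item `PartitionMinorsHitByVP` (19717): `Stmt.pieceKill`, shallow pattern (2,1)
Helper file (`--supports stmt-ValiantsHypothesis-19717`; cell valiant-natproofs, 𝒟-side door (c), line `hidden_states`, uniform-menu
lane; prover seat val-np-p3 gen 12). Definition-free; closes NO item. Second SHALLOW case of the case map toward `Stmt.pieceKill H₀`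
(memo val-np-p3 g12 §2(g), pattern (P4)): a one-piece exact-support design with a WIDE slot `f₁` (level 2 at `univ`: `|S 0 f₁| ≥ 1+h+C(h,2)`,
and `≤ (2h)²`) and a MEDIUM slot `f₂` (`h+1 ≤ |S 0 f₂| < 1+h+C(h,2)`, level 1), `n = (s₁+1)(s₂+1)` columns, is defeated for every table
(`pieceKill_pattern21`, `h ≥ 2^40`):
* `n ≤ C(h,≤4)`: the two-slot rank form at `A = univ`, levels (2,1), rows = the `n` smallest sets (all of size `≤ 4`), deficit `≥ 1`;
* `n > C(h,≤4)` (then `s₂ ≳ h²/97`): levels (2,2) inside `|A| = ⌊√s₂⌋` coordinates, rows = `n` sets of size `≤ 5` inside `A`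
  (`120·n ≤ (⌊√s₂⌋ − 4)⁵ ≤ 120·C(⌊√s₂⌋,5)`, `arith21_wide`), deficit `≥ 1`.
Tools: `det_eq_zero_of_two_slots_levels_rank` (p629996), `UniversalConstraints.rowsSmallFirst` (g6). Nothing on crux 14610 or VP ≠ VNP.
-/

set_option linter.dupNamespace false

namespace Summit.ValiantsHypothesis.ValiantsHypothesis.Theorems.BarrierLever.SimplexJoin

open Finset Matrix
open Summit.ValiantsHypothesis.ValiantsHypothesis.Theorems.BarrierLever.HiddenStates.UniversalConstraints
  (rowsSmallFirst rowsSmallFirst_injective card_small_rowsSmallFirst)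

/-- Arithmetic for `n ≤ 2^h`: `120·(s₁+1)(s₂+1) ≤ (h − 4)⁵ (≤ 120·C(h,5))` when `s₁, s₂ ≤ (2h)²`, `h ≥ 2^12`. -/
theorem arith21_pow (h s₁ s₂ : ℕ) (hh : 2 ^ 12 ≤ h) (hs₁N : s₁ ≤ (h + h) ^ 2) (hs₂N : s₂ ≤ (h + h) ^ 2) :
    120 * ((s₁ + 1) * (s₂ + 1)) ≤ (h - 4) ^ 5 := by
  obtain ⟨c, rfl⟩ : ∃ c, h = c + 4 := ⟨h - 4, by omega⟩
  have hc : 4000 ≤ c := by omega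
  have G1 : (s₁ + 1) * (s₂ + 1) ≤ (4 * (c + 4) ^ 2 + 1) * (4 * (c + 4) ^ 2 + 1) :=
    Nat.mul_le_mul (by nlinarith) (by nlinarith)
  have G2 : 4000 * (c * (c * (c * c))) ≤ c * (c * (c * (c * c))) := Nat.mul_le_mul_right _ hc
  have G3 : 4000 * (c * (c * c)) ≤ c * (c * (c * c)) := Nat.mul_le_mul_right _ hc
  have G4 : 4000 * (c * c) ≤ c * (c * c) := Nat.mul_le_mul_right _ hc
  have G5 : 4000 * c ≤ c * c := Nat.mul_le_mul_right _ hc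
  rw [show c + 4 - 4 = c by omega]
  nlinarith [G1, G2, G3, G4, G5]

/-- Arithmetic of the wide sub-case: if `(h−3)⁴ < 24·(4h²+1)·t²` (`t = ⌊√s₂⌋ + 1`) then `120·(4h²+1+1)·t² ≤ (t − 5)⁵`, for `h ≥ 2^40`. -/
theorem arith21_wide (h t : ℕ) (hh : 2 ^ 40 ≤ h) (ht : (h - 3) ^ 4 < 24 * ((h + h) ^ 2 + 1) * (t * t)) :
    120 * (((h + h) ^ 2 + 1) * (t * t)) ≤ (t - 5) ^ 5 := by
  obtain ⟨c, rfl⟩ : ∃ c, h = c + 3 := ⟨h - 3, by omega⟩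
  rw [show c + 3 - 3 = c by omega] at ht
  have hc : 2 ^ 39 ≤ c := by omega
  -- `c < 64 t`
  have hct : c < 64 * t := by
    by_contra hle
    push Not at hle
    have h1 : 64 * t * (64 * t) ≤ c * c := Nat.mul_le_mul hle hle
    have h2 : (c + 3 + (c + 3)) ^ 2 + 1 ≤ 5 * (c * c) := by nlinarith
    have h3 : 24 * ((c + 3 + (c + 3)) ^ 2 + 1) * (t * t) ≤ 24 * (5 * (c * c)) * (t * t) :=
      Nat.mul_le_mul_right _ (Nat.mul_le_mul_left _ h2)
    have h4 : 24 * (5 * (c * c)) * (t * t) * 4096 ≤ 120 * (c * c) * (c * c) := by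
      have := Nat.mul_le_mul_left (120 * (c * c)) h1
      nlinarith [this]
    nlinarith [h3, h4]
  obtain ⟨w, rfl⟩ : ∃ w, t = w + 5 := ⟨t - 5, by omega⟩
  rw [show w + 5 - 5 = w by omega]
  have hw : 2 ^ 32 ≤ w := by omega
  have G0 : (c + 3 + (c + 3)) ^ 2 + 1 ≤ 16901 * ((w + 5) * (w + 5)) := by nlinarith
  have G1 : 120 * (((c + 3 + (c + 3)) ^ 2 + 1) * ((w + 5) * (w + 5))) ≤
      120 * ((16901 * ((w + 5) * (w + 5))) * ((w + 5) * (w + 5))) :=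
    Nat.mul_le_mul_left _ (Nat.mul_le_mul_right _ G0)
  have G2 : 2 ^ 32 * (w * (w * (w * w))) ≤ w * (w * (w * (w * w))) := Nat.mul_le_mul_right _ hw
  have G3 : 2 ^ 32 * (w * (w * w)) ≤ w * (w * (w * w)) := Nat.mul_le_mul_right _ hw
  have G4 : 2 ^ 32 * (w * w) ≤ w * (w * w) := Nat.mul_le_mul_right _ hw
  have G5 : 2 ^ 32 * w ≤ w * w := Nat.mul_le_mul_right _ hw
  nlinarith [G1, G2, G3, G4, G5]

/-- **Pattern (2,1) of `Stmt.pieceKill`.** A one-piece exact-support design with a wide slot (level 2 at `univ`, `≤ (2h)²` options), a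
medium slot (level 1: `h+1 ≤ · < 1+h+C(h,2)` options) and `n = (s₁+1)(s₂+1)` columns has an injective row family on which every table is
singular (`h ≥ 2^40`). -/
theorem pieceKill_pattern21 (h D N n : ℕ) (hh : 2 ^ 40 ≤ h) (S : Fin 1 → Fin D → Finset (Fin N))
    (e : Fin n → Fin 1 × (Fin D → Option (Fin N))) (he : Function.Injective e)
    (hlive : ∀ c : Fin 1 × (Fin D → Option (Fin N)),
      c ∈ Set.range e ↔ ∀ (f : Fin D) (j : Fin N), c.2 f = some j → j ∈ S c.1 f)
    (f₁ f₂ : Fin D) (hf : f₁ ≠ f₂)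
    (hs₁ : ∑ i ∈ Finset.range 3, h.choose i ≤ (S 0 f₁).card) (hs₁N : (S 0 f₁).card ≤ (h + h) ^ 2)
    (hs₂ : ∑ i ∈ Finset.range 2, h.choose i ≤ (S 0 f₂).card) (hs₂c : (S 0 f₂).card < ∑ i ∈ Finset.range 3, h.choose i)
    (hn : n = ((S 0 f₁).card + 1) * ((S 0 f₂).card + 1)) :
    ∃ v : Fin n → Finset (Fin h), Function.Injective v ∧
      ∀ T : Fin 1 → Option (Fin D × Fin N) → Fin h → ℂ,
        (Matrix.of fun x x' : Fin n => ∏ a ∈ v x,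
          (T (e x').1 none a + ∑ f : Fin D, ((e x').2 f).elim 0 fun j => T (e x').1 (some (f, j)) a)).det = 0 := by
  classical
  set s₁ := (S 0 f₁).card with hs₁def
  set s₂ := (S 0 f₂).card with hs₂def
  have hs₂₁ : s₂ ≤ s₁ := by omega
  -- `C(h,≤2) ≤ h²`, so `s₂ < h²`
  have hc₂ : ∑ i ∈ Finset.range 3, h.choose i ≤ h * h := by
    have h1 := Nat.descFactorial_eq_factorial_mul_choose h 2
    have h2 : h.descFactorial 2 = (h - 1) * h := by simp [Nat.descFactorial_succ]
    simp only [Nat.factorial_two] at h1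
    simp only [Finset.sum_range_succ, Finset.sum_range_zero, Nat.choose_zero_right, Nat.choose_one_right, zero_add]
    obtain ⟨k, rfl⟩ : ∃ k, h = k + 2 := ⟨h - 2, by omega⟩
    rw [show k + 2 - 1 = k + 1 by omega] at h2
    nlinarith [h1, h2]
  -- `n ≤ 2^h`
  have hn2 : n ≤ 2 ^ h := by
    have h1 := Nat.pow_sub_le_descFactorial h 5
    rw [Nat.descFactorial_eq_factorial_mul_choose, show Nat.factorial 5 = 120 by rfl,
      show h + 1 - 5 = h - 4 by omega] at h1
    have h2 := (arith21_pow h s₁ s₂ (by omega) hs₁N (by nlinarith)).trans h1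
    have h3 := Nat.choose_le_two_pow h 5
    rw [hn]
    omega
  by_cases hC4 : n ≤ ∑ i ∈ Finset.range 5, h.choose i
  · -- all `n` smallest rows have size ≤ 4: rank form at `univ`, levels (2,1), deficit ≥ 1
    refine ⟨rowsSmallFirst h 5 n hn2, rowsSmallFirst_injective h 5 n hn2, fun T => ?_⟩
    refine det_eq_zero_of_two_slots_levels_rank h 2 1 1 D N n Finset.univ (rowsSmallFirst h 5 n hn2) S e he hlive 0 f₁ f₂ hf
      ?_ T
    have hsmall := card_small_rowsSmallFirst h 5 n hn2
    rw [min_eq_left hC4] at hsmall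
    have hsub : (Finset.univ.filter fun i : Fin n => (rowsSmallFirst h 5 n hn2 i).card < 5) ⊆
        (Finset.univ.filter fun i : Fin n => rowsSmallFirst h 5 n hn2 i ⊆ Finset.univ ∧
          (rowsSmallFirst h 5 n hn2 i).card ≤ 2 + 1 + 1) := by
      intro i hi
      simp only [Finset.mem_filter, Finset.mem_univ, true_and, Finset.subset_univ] at hi ⊢
      omega
    have hcard := hsmall.trans (Finset.card_le_card hsub)
    simp only [Finset.card_univ, Fintype.card_fin]
    have hx₁ : 1 ≤ s₁ + 1 - ∑ i ∈ Finset.range 3, h.choose i := by omega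
    have hx₂ : 1 ≤ s₂ + 1 - ∑ i ∈ Finset.range 2, h.choose i := by omega
    have := Nat.mul_le_mul hx₁ hx₂
    show n < _ + (s₁ + 1 - ∑ i ∈ Finset.range 3, h.choose i) * (s₂ + 1 - ∑ i ∈ Finset.range 2, h.choose i)
    omega
  · -- `n > C(h,≤4)`: levels (2,2) inside `a = ⌊√s₂⌋` coordinates
    push Not at hC4
    set a := Nat.sqrt s₂ with hadef
    have ha2 : a * a ≤ s₂ := Nat.sqrt_le s₂
    have ha2' : s₂ < (a + 1) * (a + 1) := Nat.lt_succ_sqrt s₂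
    have ha : a ≤ h := by nlinarith
    -- the key inequality `(h-3)^4 < 24 (4h²+1) (a+1)²`
    have hkey : (h - 3) ^ 4 < 24 * ((h + h) ^ 2 + 1) * ((a + 1) * (a + 1)) := by
      have h1 := Nat.pow_sub_le_descFactorial h 4
      rw [Nat.descFactorial_eq_factorial_mul_choose, show Nat.factorial 4 = 24 by rfl,
        show h + 1 - 4 = h - 3 by omega] at h1
      have h2 : h.choose 4 ≤ ∑ i ∈ Finset.range 5, h.choose i :=
        Finset.single_le_sum (f := fun i => h.choose i) (fun i _ => Nat.zero_le _) (Finset.mem_range.mpr (by norm_num : 4 < 5))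
      have h3 : n ≤ ((h + h) ^ 2 + 1) * ((a + 1) * (a + 1)) := by
        rw [hn]; exact Nat.mul_le_mul (by omega) (Nat.succ_le_of_lt ha2')
      calc (h - 3) ^ 4 ≤ 24 * h.choose 4 := h1
        _ < 24 * n := by omega
        _ ≤ 24 * (((h + h) ^ 2 + 1) * ((a + 1) * (a + 1))) := Nat.mul_le_mul_left _ h3
        _ = _ := by ring
    have hwide := arith21_wide h (a + 1) hh hkey
    rw [show a + 1 - 5 = a - 4 by omega] at hwide
    -- `n ≤ C(a,5) ≤ Σ_{i<6} C(a,i)` and `n ≤ 2^a`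
    have hdesc : (a - 4) ^ 5 ≤ 120 * a.choose 5 := by
      have h1 := Nat.pow_sub_le_descFactorial a 5
      rw [Nat.descFactorial_eq_factorial_mul_choose, show Nat.factorial 5 = 120 by rfl,
        show a + 1 - 5 = a - 4 by omega] at h1
      exact h1
    have hnC5 : n ≤ a.choose 5 := by
      have h3 : n ≤ ((h + h) ^ 2 + 1) * ((a + 1) * (a + 1)) := by
        rw [hn]; exact Nat.mul_le_mul (by omega) (Nat.succ_le_of_lt ha2')
      have : 120 * n ≤ 120 * a.choose 5 := (Nat.mul_le_mul_left _ h3).trans (hwide.trans hdesc)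
      omega
    have hn2a : n ≤ 2 ^ a := hnC5.trans (Nat.choose_le_two_pow a 5)
    have hnC : n ≤ ∑ i ∈ Finset.range 6, a.choose i :=
      hnC5.trans (Finset.single_le_sum (f := fun i => a.choose i) (fun i _ => Nat.zero_le _)
        (Finset.mem_range.mpr (by norm_num : 5 < 6)))
    have ha8 : 8 ≤ a := by
      by_contra hlt
      have : a.choose 5 ≤ 2 ^ a := Nat.choose_le_two_pow a 5
      have h128 : 2 ^ a ≤ 2 ^ 7 := Nat.pow_le_pow_right (by norm_num) (by omega)
      have : (h - 3) ^ 4 ≥ 1 := Nat.one_le_pow _ _ (by omega)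
      nlinarith [hC4, hnC5]
    -- the rows: small subsets of the first `a` coordinates
    let emb : Fin a ↪ Fin h := Fin.castLEEmb ha
    set A : Finset (Fin h) := (Finset.univ : Finset (Fin a)).map emb with hA
    have hAcard : A.card = a := by simp [hA]
    let v : Fin n → Finset (Fin h) := fun i => (rowsSmallFirst a 6 n hn2a i).map emb
    have hv : Function.Injective v := by
      intro i i' hii'
      exact rowsSmallFirst_injective a 6 n hn2a ((Finset.map_injective emb) hii')
    refine ⟨v, hv, fun T => ?_⟩
    refine det_eq_zero_of_two_slots_levels_rank h 2 2 1 D N n A v S e he hlive 0 f₁ f₂ hf ?_ T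
    have hall : ∀ i, (rowsSmallFirst a 6 n hn2a i).card < 6 := by
      have hsmall := card_small_rowsSmallFirst a 6 n hn2a
      rw [min_eq_left hnC] at hsmall
      have heq : (Finset.univ.filter fun i : Fin n => (rowsSmallFirst a 6 n hn2a i).card < 6) = Finset.univ :=
        Finset.eq_univ_of_card _ (le_antisymm (Finset.card_filter_le _ _ |>.trans (by simp)) (by simpa using hsmall))
      intro i
      have : i ∈ (Finset.univ.filter fun i : Fin n => (rowsSmallFirst a 6 n hn2a i).card < 6) := by
        rw [heq]; exact Finset.mem_univ i
      exact (Finset.mem_filter.mp this).2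
    have hSmall : (Finset.univ.filter fun i : Fin n => v i ⊆ A ∧ (v i).card ≤ 2 + 2 + 1) = Finset.univ := by
      refine Finset.eq_univ_of_forall fun i => Finset.mem_filter.mpr ⟨Finset.mem_univ _, ?_, ?_⟩
      · exact Finset.map_subset_map.mpr (Finset.subset_univ _)
      · have := hall i
        simp only [v, Finset.card_map]
        omega
    rw [hSmall, Finset.card_univ, Fintype.card_fin, hAcard]
    -- levels (2,2) inside `A`: `C(a,≤2) ≤ a² ≤ s₂ ≤ s₁`
    have hlev : ∑ i ∈ Finset.range 3, a.choose i ≤ s₂ := by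
      have h1 := Nat.descFactorial_eq_factorial_mul_choose a 2
      have h2 : a.descFactorial 2 = (a - 1) * a := by simp [Nat.descFactorial_succ]
      simp only [Nat.factorial_two] at h1
      simp only [Finset.sum_range_succ, Finset.sum_range_zero, Nat.choose_zero_right, Nat.choose_one_right, zero_add]
      obtain ⟨k, hk⟩ : ∃ k, a = k + 8 := ⟨a - 8, by omega⟩
      rw [hk] at h1 h2 ha2 ⊢
      rw [show k + 8 - 1 = k + 7 by omega] at h2
      nlinarith [h1, h2, ha2]
    have hx₁ : 1 ≤ s₁ + 1 - ∑ i ∈ Finset.range 3, a.choose i := by omega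
    have hx₂ : 1 ≤ s₂ + 1 - ∑ i ∈ Finset.range 3, a.choose i := by omega
    have := Nat.mul_le_mul hx₁ hx₂
    show n < n + (s₁ + 1 - ∑ i ∈ Finset.range 3, a.choose i) * (s₂ + 1 - ∑ i ∈ Finset.range 3, a.choose i)
    omega

end Summit.ValiantsHypothesis.ValiantsHypothesis.Theorems.BarrierLever.SimplexJoin
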